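import Mathlib
import HarnessLib
import Summits.HubbardSuperconductivity.HubbardSuperconductivity.Theorems.KLProgrammeH10TwoPointLimitSymbolLineDerivTwo
import Literature.MathematicalPhysics.QuantumLattice.FermiRG.BGM2006Sec2ShellLineBounds
import Summits.HubbardSuperconductivity.HubbardSuperconductivity.Theorems.KLProgrammeSectorisedLegKernelsDefs

/-!
# Route `KLProgramme` — engine support, route (L2) symbol layer: the scale-`n` CUTOFF PROFILE `u ↦ H₀(4ⁿ√u) = bgmCutoffSq e₀ (16ⁿu)` as an
# instance of the generic profile hypotheses (`|G| ≤ 1`, `|G′| ≤ d e₀²/Λ_n²`, `|G″| ≤ d e₀⁴/Λ_n⁴`, `G = 0` above `Λ_n²`), and the product of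
# two such profiles at the finer scale

Cell `gate-hubbard-kl`, seat p4 (C5a lead), g6; HOME/prover-p4/FRAME-L22-NOTE.md §3″ (d).  The cutoff factor of the sector multiplier
`bgmMultiplier …n` / `klAnisoFamily … n` at a frequency–momentum with squared denominator `u = k₀² + e_K²` is `C_h⁻¹(√u) = H₀(4ⁿ√u)`
(`gnScaleCutoff 4 e₀ (−n)`), i.e. `bgmCutoffSq e₀ (16ⁿ u)` with t1's globally smooth surrogate `bgmCutoffSq e₀ = H₀ ∘ √`
(`gnScaleCutoff_sqrt_eq_bgmCutoffSq`).  Its first two derivatives are bounded (`exists_abs_derivs_bgmCutoffSq_le`: they vanish off the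
compact transition interval), so the rescaled profile satisfies the hypotheses of `…SymbolLineDerivTwo` / `…SymbolProductSampled` with
`Λ = Λ_n = klScale e₀ n` (**`scaleProfile_bounds`**), and the product of the profiles of two scales is a profile at the finer scale
(**`scaleProfile_mul_bounds`**, via `profile_mul`).  Everything is proved; no definitions, no named facts. [folklore]
-/

noncomputable section

namespace Summit.HubbardSuperconductivity.HubbardSuperconductivity.Theorems.TorusFourierL2

set_option linter.dupNamespace false -- summit = problem name (single-conjunct summit), D-0017

open Set Filter Topology Literature.MathematicalPhysics.QuantumLattice Literature.MathematicalPhysics.QuantumLattice.FermiRG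
open Summit.HubbardSuperconductivity.HubbardSuperconductivity.Theorems.KLProgrammeLegKernels
open scoped Real

/-! ### §1 The surrogate and its scale form -/

/-- **`C_h⁻¹(√u) = bgmCutoffSq e₀ (16ⁿ u)`** (`h = −n`): `H₀(4ⁿ√u) = H₀(√(16ⁿu))`. [cite: BenfattoGiulianiMastropietro2006, §2.3 (2.19)] -/
theorem gnScaleCutoff_sqrt_eq_bgmCutoffSq (e₀ : ℝ) (n : ℕ) (u : ℝ) :
    gnScaleCutoff 4 e₀ (-(n : ℤ)) (Real.sqrt u) = bgmCutoffSq e₀ ((16 : ℝ) ^ n * u) := by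
  rw [gnScaleCutoff, bgmCutoffSq, neg_neg, zpow_natCast]
  congr 1
  have h16 : (16 : ℝ) ^ n = ((4 : ℝ) ^ n) ^ 2 := by rw [← pow_mul, mul_comm, pow_mul]; norm_num
  rw [h16, Real.sqrt_mul (by positivity), Real.sqrt_sq (by positivity)]

/-- `16ⁿ = e₀²/Λ_n²` for `Λ_n = klScale e₀ n = e₀ 4^{-n}` (`e₀ ≠ 0`). [folklore] -/
theorem sixteen_pow_eq (n : ℕ) {e₀ : ℝ} (he : e₀ ≠ 0) : (16 : ℝ) ^ n = e₀ ^ 2 / klScale e₀ n ^ 2 := by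
  rw [klScale]
  have h4 : (4 : ℝ) ^ n ≠ 0 := by positivity
  have h16 : (16 : ℝ) ^ n = ((4 : ℝ) ^ n) ^ 2 := by rw [← pow_mul, mul_comm, pow_mul]; norm_num
  rw [h16]
  field_simp

/-! ### §2 Global bounds for the first two derivatives of the surrogate -/

/-- The surrogate is `1` on the open half-line `u < e₀²/16` and `0` on `u > e₀²` (`e₀ > 0`). [folklore] -/
theorem bgmCutoffSq_eq_const {e₀ : ℝ} (he : 0 < e₀) {u : ℝ} :
    (u < e₀ ^ 2 / 16 → bgmCutoffSq e₀ u = 1) ∧ (e₀ ^ 2 < u → bgmCutoffSq e₀ u = 0) := by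
  constructor
  · intro hu
    rw [bgmCutoffSq]
    refine gnCutoff_eq_one (by norm_num) he ?_
    rcases le_or_gt u 0 with h0 | h0
    · rw [Real.sqrt_eq_zero'.2 h0]; positivity
    · rw [show e₀ / 4 = Real.sqrt (e₀ ^ 2 / 16) by
        rw [show e₀ ^ 2 / 16 = (e₀ / 4) ^ 2 by ring, Real.sqrt_sq (by positivity)]]
      exact Real.sqrt_le_sqrt hu.le
  · intro hu
    rw [bgmCutoffSq]
    refine gnCutoff_eq_zero (by norm_num) he ?_
    rw [show e₀ = Real.sqrt (e₀ ^ 2) by rw [Real.sqrt_sq he.le]]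
    exact Real.sqrt_le_sqrt hu.le

/-- **The first two derivatives of the surrogate are globally bounded**: `∃ d ≥ 0, |bgmCutoffSq′| ≤ d ∧ |bgmCutoffSq″| ≤ d` (they vanish off
the compact transition interval `[e₀²/16, e₀²]` and are continuous). [folklore] -/
theorem exists_abs_derivs_bgmCutoffSq_le {e₀ : ℝ} (he : 0 < e₀) :
    ∃ d : ℝ, 0 ≤ d ∧ (∀ u, |deriv (bgmCutoffSq e₀) u| ≤ d) ∧ (∀ u, |iteratedDeriv 2 (bgmCutoffSq e₀) u| ≤ d) := by
  have hC : ∀ m : ℕ, ContDiff ℝ m (bgmCutoffSq e₀) := fun m => contDiff_bgmCutoffSq he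
  -- vanishing of the derivatives off the transition interval
  have hvan : ∀ (m : ℕ), 1 ≤ m → ∀ u, (u < e₀ ^ 2 / 16 ∨ e₀ ^ 2 < u) → iteratedDeriv m (bgmCutoffSq e₀) u = 0 := by
    intro m hm u hu
    rcases hu with hu | hu
    · have hev : bgmCutoffSq e₀ =ᶠ[𝓝 u] fun _ => (1 : ℝ) := by
        filter_upwards [Iio_mem_nhds hu] with v hv using (bgmCutoffSq_eq_const he).1 hv
      rw [hev.iteratedDeriv_eq, iteratedDeriv_const]; simp [show m ≠ 0 by omega]
    · have hev : bgmCutoffSq e₀ =ᶠ[𝓝 u] fun _ => (0 : ℝ) := by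
        filter_upwards [Ioi_mem_nhds hu] with v hv using (bgmCutoffSq_eq_const he).2 hv
      rw [hev.iteratedDeriv_eq, iteratedDeriv_const]; simp
  -- continuity gives a bound on the compact interval
  have hbd : ∀ m : ℕ, 1 ≤ m → ∃ C, 0 ≤ C ∧ ∀ u, |iteratedDeriv m (bgmCutoffSq e₀) u| ≤ C := by
    intro m hm
    have hcont : Continuous (iteratedDeriv m (bgmCutoffSq e₀)) := (hC m).continuous_iteratedDeriv' m
    obtain ⟨C, hC'⟩ := (isCompact_Icc (a := e₀ ^ 2 / 16) (b := e₀ ^ 2)).exists_bound_of_continuousOn hcont.continuousOn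
    refine ⟨max C 0, le_max_right _ _, fun u => ?_⟩
    by_cases hu : u ∈ Icc (e₀ ^ 2 / 16) (e₀ ^ 2)
    · exact ((Real.norm_eq_abs _).symm.le.trans (hC' u hu)).trans (le_max_left _ _)
    · rw [mem_Icc, not_and_or, not_le, not_le] at hu
      rw [hvan m hm u hu, abs_zero]; exact le_max_right _ _
  obtain ⟨C₁, hC₁0, hC₁⟩ := hbd 1 le_rfl
  obtain ⟨C₂, hC₂0, hC₂⟩ := hbd 2 (by norm_num)
  refine ⟨max C₁ C₂, le_max_of_le_left hC₁0, fun u => ?_, fun u => (hC₂ u).trans (le_max_right _ _)⟩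
  have h := hC₁ u
  rw [iteratedDeriv_one] at h
  exact h.trans (le_max_left _ _)

/-! ### §3 The rescaled profile of scale `n` -/

/-- Derivatives of `u ↦ g(c·u)`: `(g(c·))′ = c·g′(c·)`, `(g(c·))″ = c²·g″(c·)` for `g ∈ C²`. [folklore] -/
theorem derivs_comp_mul_left {g : ℝ → ℝ} (hg : ContDiff ℝ 2 g) (c u : ℝ) :
    deriv (fun u => g (c * u)) u = c * deriv g (c * u) ∧ iteratedDeriv 2 (fun u => g (c * u)) u = c ^ 2 * iteratedDeriv 2 g (c * u) := by
  have h2 : (2 : WithTop ℕ∞) ≠ 0 := by norm_num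
  have hlin : ∀ u : ℝ, HasDerivAt (fun u : ℝ => c * u) c u := fun u => by
    simpa using (hasDerivAt_id u).const_mul c
  have hd : ∀ u, HasDerivAt (fun u => g (c * u)) (deriv g (c * u) * c) u := fun u =>
    ((hg.differentiable h2) (c * u)).hasDerivAt.comp u (hlin u)
  have hd1 : deriv (fun u => g (c * u)) = fun u => c * deriv g (c * u) := funext fun u => by rw [(hd u).deriv]; ring
  refine ⟨by rw [hd1], ?_⟩
  rw [iteratedDeriv_succ, iteratedDeriv_one, hd1]
  have hB : HasDerivAt (fun u => deriv g (c * u)) (iteratedDeriv 2 g (c * u) * c) u :=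
    (hasDerivAt_deriv_of_contDiff_two hg (c * u)).comp u (hlin u)
  rw [(hB.const_mul c).deriv]; ring

/-- **The scale-`n` profile satisfies the generic profile hypotheses** with `Λ = Λ_n = klScale e₀ n`: for `Gₙ(u) = bgmCutoffSq e₀ (16ⁿ u)` and
`d` a bound of `|bgmCutoffSq′|, |bgmCutoffSq″|`: `Gₙ ∈ C²`, `|Gₙ| ≤ 1`, `|Gₙ′| ≤ d e₀²/Λ_n²`, `|Gₙ″| ≤ d e₀⁴/Λ_n⁴`, `Gₙ(u) = 0` for `u > Λ_n²`.
[cite: BenfattoGiulianiMastropietro2006, §2.3 (2.19), §2.5 (2.53)] -/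
theorem scaleProfile_bounds {e₀ : ℝ} (he : 0 < e₀) (n : ℕ) {d : ℝ} (hd1 : ∀ u, |deriv (bgmCutoffSq e₀) u| ≤ d)
    (hd2 : ∀ u, |iteratedDeriv 2 (bgmCutoffSq e₀) u| ≤ d) :
    ContDiff ℝ 2 (fun u => bgmCutoffSq e₀ ((16 : ℝ) ^ n * u)) ∧ (∀ u, |bgmCutoffSq e₀ ((16 : ℝ) ^ n * u)| ≤ 1) ∧
      (∀ u, |deriv (fun u => bgmCutoffSq e₀ ((16 : ℝ) ^ n * u)) u| ≤ d * e₀ ^ 2 / klScale e₀ n ^ 2) ∧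
      (∀ u, |iteratedDeriv 2 (fun u => bgmCutoffSq e₀ ((16 : ℝ) ^ n * u)) u| ≤ d * e₀ ^ 4 / klScale e₀ n ^ 4) ∧
      (∀ u, klScale e₀ n ^ 2 < u → bgmCutoffSq e₀ ((16 : ℝ) ^ n * u) = 0) := by
  have hC : ContDiff ℝ 2 (bgmCutoffSq e₀) := contDiff_bgmCutoffSq he
  have hΛ : 0 < klScale e₀ n := by rw [klScale]; positivity
  have h16 : (16 : ℝ) ^ n = e₀ ^ 2 / klScale e₀ n ^ 2 := sixteen_pow_eq n he.ne'
  refine ⟨hC.comp (contDiff_const.mul contDiff_id), fun u => abs_bgmCutoffSq_le_one e₀ _, fun u => ?_, fun u => ?_, fun u hu => ?_⟩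
  · rw [(derivs_comp_mul_left hC _ u).1, abs_mul, abs_of_pos (by positivity : (0 : ℝ) < (16 : ℝ) ^ n)]
    calc (16 : ℝ) ^ n * |deriv (bgmCutoffSq e₀) ((16 : ℝ) ^ n * u)| ≤ (16 : ℝ) ^ n * d :=
          mul_le_mul_of_nonneg_left (hd1 _) (by positivity)
      _ = d * e₀ ^ 2 / klScale e₀ n ^ 2 := by rw [h16]; ring
  · rw [(derivs_comp_mul_left hC _ u).2, abs_mul, abs_of_pos (by positivity : (0 : ℝ) < ((16 : ℝ) ^ n) ^ 2)]
    calc ((16 : ℝ) ^ n) ^ 2 * |iteratedDeriv 2 (bgmCutoffSq e₀) ((16 : ℝ) ^ n * u)| ≤ ((16 : ℝ) ^ n) ^ 2 * d :=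
          mul_le_mul_of_nonneg_left (hd2 _) (by positivity)
      _ = d * e₀ ^ 4 / klScale e₀ n ^ 4 := by rw [h16]; ring
  · refine (bgmCutoffSq_eq_const he).2 ?_
    rw [h16]
    have hΛ2 : 0 < klScale e₀ n ^ 2 := by positivity
    have he2 : 0 < e₀ ^ 2 := by positivity
    rw [div_mul_eq_mul_div, lt_div_iff₀ hΛ2]
    nlinarith [mul_lt_mul_of_pos_left hu he2]

/-- **The product of the profiles of two scales `n₂ ≤ n₁` is a profile at the finer scale `Λ_{n₁}`** with constants
`(1, 2d e₀², (2d + 2d²) e₀⁴)`. [folklore] -/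
theorem scaleProfile_mul_bounds {e₀ : ℝ} (he : 0 < e₀) {n₁ n₂ : ℕ} (hn : n₂ ≤ n₁) {d : ℝ} (hd : 0 ≤ d)
    (hd1 : ∀ u, |deriv (bgmCutoffSq e₀) u| ≤ d) (hd2 : ∀ u, |iteratedDeriv 2 (bgmCutoffSq e₀) u| ≤ d) :
    ContDiff ℝ 2 (fun u => bgmCutoffSq e₀ ((16 : ℝ) ^ n₁ * u) * bgmCutoffSq e₀ ((16 : ℝ) ^ n₂ * u)) ∧
      (∀ u, |bgmCutoffSq e₀ ((16 : ℝ) ^ n₁ * u) * bgmCutoffSq e₀ ((16 : ℝ) ^ n₂ * u)| ≤ 1 * 1) ∧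
      (∀ u, |deriv (fun u => bgmCutoffSq e₀ ((16 : ℝ) ^ n₁ * u) * bgmCutoffSq e₀ ((16 : ℝ) ^ n₂ * u)) u| ≤
        (d * e₀ ^ 2 * 1 + 1 * (d * e₀ ^ 2)) / klScale e₀ n₁ ^ 2) ∧
      (∀ u, |iteratedDeriv 2 (fun u => bgmCutoffSq e₀ ((16 : ℝ) ^ n₁ * u) * bgmCutoffSq e₀ ((16 : ℝ) ^ n₂ * u)) u| ≤
        (d * e₀ ^ 4 * 1 + 2 * (d * e₀ ^ 2) * (d * e₀ ^ 2) + 1 * (d * e₀ ^ 4)) / klScale e₀ n₁ ^ 4) ∧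
      (∀ u, klScale e₀ n₁ ^ 2 < u → bgmCutoffSq e₀ ((16 : ℝ) ^ n₁ * u) * bgmCutoffSq e₀ ((16 : ℝ) ^ n₂ * u) = 0) := by
  obtain ⟨hc₁, ha₁, hb₁, hdd₁, hv₁⟩ := scaleProfile_bounds he n₁ hd1 hd2
  obtain ⟨hc₂, ha₂, hb₂, hdd₂, -⟩ := scaleProfile_bounds he n₂ hd1 hd2
  have hΛ₁ : 0 < klScale e₀ n₁ := by rw [klScale]; positivity
  have hΛ₁₂ : klScale e₀ n₁ ≤ klScale e₀ n₂ := by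
    rw [klScale, klScale]
    refine mul_le_mul_of_nonneg_left ?_ he.le
    exact inv_anti₀ (by positivity) (pow_le_pow_right₀ (by norm_num) hn)
  have hb₁' : ∀ u, |deriv (fun u => bgmCutoffSq e₀ ((16 : ℝ) ^ n₁ * u)) u| ≤ d * e₀ ^ 2 / klScale e₀ n₁ ^ 2 := hb₁
  have hb₂' : ∀ u, |deriv (fun u => bgmCutoffSq e₀ ((16 : ℝ) ^ n₂ * u)) u| ≤ d * e₀ ^ 2 / klScale e₀ n₂ ^ 2 := hb₂
  exact profile_mul hc₁ hc₂ hΛ₁ hΛ₁₂ zero_le_one (by positivity) (by positivity) (by positivity) ha₁ hb₁' hdd₁ ha₂ hb₂' hdd₂ hv₁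

end Summit.HubbardSuperconductivity.HubbardSuperconductivity.Theorems.TorusFourierL2

end
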